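import Mathlib
import Summits.NavierStokesRegularity.NavierStokesRegularity.Theorems.EulerZoomLiouvillePowerGaugeEulerLiouvilleHoopInequality
import Summits.NavierStokesRegularity.NavierStokesRegularity.Theorems.EulerZoomLiouvillePowerGaugeEulerLiouvilleHoopAxisAtom
import HarnessLib

/-!
# Hoop core — THE HOOP INEQUALITY WITH THE TRANSVERSE AXIS ATOM, and its axis-law units

Sub-problem `NavierStokesRegularity`, crux `PowerGaugeEulerLiouville` (a crux CLASS of self-similar Euler/NS strata on the
MODEL lattice — not NS regularity, not E).  Seat ns-ezl-w3 g7 (tag HOOP-TR; nsreg-p2 R48 referee item F5, typed cell-side as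
`NsregP2.R48.HoopInequalityTransverse`).

* `hoopInequalityTransverse` — for every `C¹` divergence-free `V` and every solid cylinder `Z = solidCyl s₁ s₂ T₀` (`s₁ < s₂`,
  `0 < T₀`):  `∫_Z hoopDensity V ≤ ∫_Z |DV|_F² + π ∫_{s₁}^{s₂} (‖V(σe_z)‖² − V_z(σe_z)²) dσ + endFlux V s₁ T₀ + endFlux V s₂ T₀`.
  Same proof as the tree's `hoopInequality` (ns-sfl-p1 g8, from ns-ezl-w2 g5's `hoop_box_le`), except that the axis atom of
  `hoop_box_le_chart` is used through the EQUALITY `sliceChart_atom` (`= π(v₀² + v₁²) = π(‖v‖² − v_z²)`) instead of the bound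
  `≤ π‖v‖²`: the TRANSVERSE atom.  It implies `HoopInequality` (`V_z² ≥ 0`) and is the form that cancels EXACTLY against the axis
  atom `−½(‖V(σe_z)‖² − V_z(σe_z)²)` of the axis law (`…HoopAxisLaw`, `AxisLawCentre`) — R48 §8 (1): full price `½γ(1−γ)`, not `½γ(1−2γ)`.
* `hoop_axisUnits_le` — the same inequality with the left side written as the HOOP TERM of the axis law:
  `2π ∫_{s₁}^{s₂} ∫₀^{T₀} ⟨V_r² − V_θ²⟩_θ(σ,t) dt/t dσ ≤ ∫_Z |DV|_F² + π∫(‖V(σe_z)‖² − V_z(σe_z)²) + endFlux s₁ + endFlux s₂`.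
(The full-atom form `HoopCore.hoopInequality` is the tree's, ns-sfl-p1 g8; it follows from this one since `V_z² ≥ 0`.)

WHAT THIS IS NOT: not NS, not E — a class-free functional inequality; 19832 OPEN; NS regularity NOT proved.
[ns-idea-11 g8 HOOP NOTE §4; nsreg-p2 ROUND-48 F5]
-/

noncomputable section

open MeasureTheory Set WithLp Metric Real Function
open scoped InnerProductSpace RealInnerProductSpace

set_option linter.dupNamespace false

namespace Summit.NavierStokesRegularity.NavierStokesRegularity.Theorems.PowerGaugeEulerLiouville.HoopCore

open Literature.Analysis Literature.Analysis.FluidPDE Condenser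

variable {V : EuclideanSpace ℝ (Fin 3) → EuclideanSpace ℝ (Fin 3)}

/-- **The integrated axis atom IS `π ∫ (‖V(σe_z)‖² − V_z(σe_z)²)`** (the transverse kinetic energy on the axis; `V` continuous,
any `s₁, s₂`): the first-mode energy of `hoop_box_le_chart` summed over the segment. [folklore] -/
theorem integral_sliceChart_atom_eq (V : EuclideanSpace ℝ (Fin 3) → EuclideanSpace ℝ (Fin 3)) (s₁ s₂ : ℝ) :
    ∫ σ in s₁..s₂, π⁻¹ * ((∫ y in (0 : ℝ)..2 * π,
        ⟪V (axisPt σ 0 y), rotZ y (EuclideanSpace.single (0 : Fin 3) (1 : ℝ))⟫ * Real.cos y) ^ 2 +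
      (∫ y in (0 : ℝ)..2 * π,
        ⟪V (axisPt σ 0 y), rotZ y (EuclideanSpace.single (0 : Fin 3) (1 : ℝ))⟫ * Real.sin y) ^ 2) =
      Real.pi * ∫ σ in s₁..s₂, (‖V (σ • eZ)‖ ^ 2 - (axialVelocity V (σ • eZ)) ^ 2) := by
  rw [← intervalIntegral.integral_const_mul]
  refine intervalIntegral.integral_congr fun σ _ => ?_
  rw [sliceChart_atom V σ, axialVelocity, norm_sq_sub_sq_two]

/-- **THE HOOP INEQUALITY WITH THE TRANSVERSE AXIS ATOM** (HOOP-NOTE §4; nsreg-p2 R48 F5 `HoopInequalityTransverse`):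
for every `C¹` divergence-free `V` and every solid cylinder `Z = solidCyl s₁ s₂ T₀` about the `x₂`-axis (`s₁ < s₂`, `0 < T₀`),
`∫_Z hoopDensity V ≤ ∫_Z |DV|_F² + π ∫_{s₁}^{s₂} (‖V(σ e_z)‖² − V_z(σ e_z)²) dσ + endFlux V s₁ T₀ + endFlux V s₂ T₀`.
[ns-idea-11 g8 HOOP NOTE §4] -/
theorem hoopInequalityTransverse :
    ∀ (V : EuclideanSpace ℝ (Fin 3) → EuclideanSpace ℝ (Fin 3)) (s₁ s₂ T₀ : ℝ), s₁ < s₂ → 0 < T₀ → ContDiff ℝ 1 V →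
      (∀ y, VectorCalculus.divergence V y = 0) →
        ∫ y in solidCyl s₁ s₂ T₀, hoopDensity V y
          ≤ (∫ y in solidCyl s₁ s₂ T₀, frobeniusNormSq (fderiv ℝ V y))
            + Real.pi * (∫ σ in s₁..s₂, (‖V (σ • eZ)‖ ^ 2 - (axialVelocity V (σ • eZ)) ^ 2))
            + endFlux V s₁ T₀ + endFlux V s₂ T₀ := by
  intro V s₁ s₂ T₀ hs hT₀ hV hdiv
  have hVc : Continuous V := hV.continuous
  have hbox := hoop_box_le_chart hV hdiv hs.le hT₀
  have hF := sliceChart_fourEntries_le_frobenius hV hs.le hT₀.le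
  have hA := integral_sliceChart_atom_eq V s₁ s₂
  have hE₁ := sliceChart_endFlux hVc s₁ hT₀
  have hE₂ := sliceChart_endFlux hVc s₂ hT₀
  -- reorder the four entries (`aσ² + mz²` versus `mz² + aσ²`)
  have hswap : (∫ σ in s₁..s₂, ∫ t in (0 : ℝ)..T₀, t * ∫ θ in (0 : ℝ)..2 * π,
      (⟪fderiv ℝ V (axisPt σ t θ) (rotZ θ (EuclideanSpace.single (1 : Fin 3) (1 : ℝ))),
          rotZ θ (EuclideanSpace.single (0 : Fin 3) (1 : ℝ))⟫ ^ 2 +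
        ⟪fderiv ℝ V (axisPt σ t θ) (rotZ θ (EuclideanSpace.single (1 : Fin 3) (1 : ℝ))),
          rotZ θ (EuclideanSpace.single (1 : Fin 3) (1 : ℝ))⟫ ^ 2 +
        ⟪fderiv ℝ V (axisPt σ t θ) eZ, rotZ θ (EuclideanSpace.single (0 : Fin 3) (1 : ℝ))⟫ ^ 2 +
        ⟪fderiv ℝ V (axisPt σ t θ) (rotZ θ (EuclideanSpace.single (1 : Fin 3) (1 : ℝ))), eZ⟫ ^ 2)) =
      ∫ σ in s₁..s₂, ∫ t in (0 : ℝ)..T₀, t * ∫ θ in (0 : ℝ)..2 * π,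
        (⟪fderiv ℝ V (axisPt σ t θ) (rotZ θ (EuclideanSpace.single (1 : Fin 3) (1 : ℝ))),
            rotZ θ (EuclideanSpace.single (0 : Fin 3) (1 : ℝ))⟫ ^ 2 +
          ⟪fderiv ℝ V (axisPt σ t θ) (rotZ θ (EuclideanSpace.single (1 : Fin 3) (1 : ℝ))),
            rotZ θ (EuclideanSpace.single (1 : Fin 3) (1 : ℝ))⟫ ^ 2 +
          ⟪fderiv ℝ V (axisPt σ t θ) (rotZ θ (EuclideanSpace.single (1 : Fin 3) (1 : ℝ))), eZ⟫ ^ 2 +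
          ⟪fderiv ℝ V (axisPt σ t θ) eZ, rotZ θ (EuclideanSpace.single (0 : Fin 3) (1 : ℝ))⟫ ^ 2) := by
    refine intervalIntegral.integral_congr fun σ _ => intervalIntegral.integral_congr fun t _ => ?_
    congr 1
    exact intervalIntegral.integral_congr fun θ _ => by ring
  rw [setIntegral_hoopDensity_eq_sliceChart hV hs.le hT₀]
  rw [hswap] at hbox
  linarith

/-- The hoop term of the axis law in slice form: `∫₀^{T₀} ⟨V_r² − V_θ²⟩(σ,t) dt/t = (2π)⁻¹ ∫₀^{T₀} t⁻¹ ∫₀^{2π} (a² − b²) dθ dt`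
(`T₀ ≥ 0`; local copy of ns-sfl-p1 g8's `axisHoopTerm_eq_sliceLHS`, via `circleAvg_hoop_eq_chart`). [folklore] -/
private theorem axisHoopTerm_eq_sliceLHS_loc (V : EuclideanSpace ℝ (Fin 3) → EuclideanSpace ℝ (Fin 3)) (σ : ℝ) {T₀ : ℝ}
    (hT₀ : 0 ≤ T₀) :
    ∫ t in (0 : ℝ)..T₀, circleAvg (fun y => radialVelocity V y ^ 2 - swirlVelocity V y ^ 2) σ t / t =
      1 / (2 * Real.pi) * ∫ t in (0 : ℝ)..T₀, t⁻¹ * ∫ θ in (0 : ℝ)..2 * π,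
        (⟪V (axisPt σ t θ), rotZ θ (EuclideanSpace.single (0 : Fin 3) (1 : ℝ))⟫ ^ 2 -
          ⟪V (axisPt σ t θ), rotZ θ (EuclideanSpace.single (1 : Fin 3) (1 : ℝ))⟫ ^ 2) := by
  rw [← intervalIntegral.integral_const_mul]
  refine intervalIntegral.integral_congr_ae (ae_of_all _ fun t ht => ?_)
  rw [uIoc_of_le hT₀] at ht
  rw [circleAvg_hoop_eq_chart V σ ht.1, div_eq_mul_inv]
  ring

/-- **THE HOOP INEQUALITY IN AXIS-LAW UNITS**: for `C¹` divergence-free `V`, `s₁ < s₂`, `0 < T₀`, the hoop term of the axis law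
satisfies `2π ∫_{s₁}^{s₂} ∫₀^{T₀} ⟨V_r² − V_θ²⟩_θ(σ,t) dt/t dσ ≤ ∫_Z |DV|_F² + π ∫ (‖V(σe_z)‖² − V_z(σe_z)²) dσ + endFlux s₁ + endFlux s₂`
(`∫_Z hoopDensity = 2π ∫σ∫t ⟨V_r² − V_θ²⟩/t`, `setIntegral_hoopDensity_eq_sliceChart` + the slice form of the hoop term). [folklore] -/
theorem hoop_axisUnits_le (hV : ContDiff ℝ 1 V) (hdiv : ∀ y, VectorCalculus.divergence V y = 0) {s₁ s₂ T₀ : ℝ}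
    (hs : s₁ < s₂) (hT₀ : 0 < T₀) :
    2 * Real.pi * ∫ σ in s₁..s₂, ∫ t in (0 : ℝ)..T₀,
        circleAvg (fun y => radialVelocity V y ^ 2 - swirlVelocity V y ^ 2) σ t / t
      ≤ (∫ y in solidCyl s₁ s₂ T₀, frobeniusNormSq (fderiv ℝ V y))
          + Real.pi * (∫ σ in s₁..s₂, (‖V (σ • eZ)‖ ^ 2 - (axialVelocity V (σ • eZ)) ^ 2))
          + endFlux V s₁ T₀ + endFlux V s₂ T₀ := by
  have h := hoopInequalityTransverse V s₁ s₂ T₀ hs hT₀ hV hdiv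
  have hlhs : 2 * Real.pi * ∫ σ in s₁..s₂, ∫ t in (0 : ℝ)..T₀,
      circleAvg (fun y => radialVelocity V y ^ 2 - swirlVelocity V y ^ 2) σ t / t =
      ∫ y in solidCyl s₁ s₂ T₀, hoopDensity V y := by
    rw [setIntegral_hoopDensity_eq_sliceChart hV hs.le hT₀,
      intervalIntegral.integral_congr (fun σ _ => axisHoopTerm_eq_sliceLHS_loc V σ hT₀.le), intervalIntegral.integral_const_mul]
    have hπ : (2 * Real.pi) ≠ 0 := by positivity
    field_simp
  rw [hlhs]
  exact h

end Summit.NavierStokesRegularity.NavierStokesRegularity.Theorems.PowerGaugeEulerLiouville.HoopCore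

end
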